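import Summits.QuantumFields.BalabanUV.T4Continuum.Spine.NE1p.DressedJointAnalyticOnCores
import Summits.QuantumFields.BalabanUV.T4Continuum.Spine.NE1p.DressedSmallFieldOnCoresSlotLetters

/-!
# T⁴ programme, spine estimate NE1′ (node O3b/H2) — THE SOURCE-ANALYTIC, RESPONSE AND JOINT ENDs AND ROW NE5's `TermLineAnalytic`
# AT THE SUBSTRATE'S GAUSSIAN LETTERS OF RECORD: S33 §4's two slot ENDs and S42 §2∕§5 at `ℓ := coreLettersOf A`, N0r's three
# operator-letter blocks `hm` ∕ `hN` ∕ `hq` DISCHARGED by S30 §1 into the substrate's primitive scalar letter conditions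

Cell `pub-balaban`, sub-cell `t4`, BINDER-OWNERS row NE1′; NE1′ formalisation crew, unit `b2b-balaban-t4-ne1p-formalise-leaf-03`
(LEAF PROVER 03, generation 13); crew row S⟨next⟩ of `t4/formal/NE1p/LEAVES.md` (own-lineage follower of S33 `DressedSourceAnalyticOnCores`
(p230131) and S42 `DressedJointAnalyticOnCores` (p233022), in crew row S30 `DressedSmallFieldOnCoresSlotLetters` (leaf-01, p228879)'s
scope and pattern).  ADDITIVE — imports S42 `Spine/NE1p/DressedJointAnalyticOnCores` (→ S33 → N0r∕N0q∕N0p∕N0n, row NE5's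
`OutputRateOpGaussianParam` ∕ `B13TermParamGaussianBi{,Prod}`) and S30 `Spine/NE1p/DressedSmallFieldOnCoresSlotLetters` (→ N0r, the
SUBSTRATE cell's `Support/SubstrateGaussianLettersBall` (p219975) ∕ `SubstrateGaussianLetters` (p219426) ∕ `SubstrateSlotsOfRecord`
(p220104)) ONLY; THEOREMS ONLY (0 def, 0 `def … : Prop`, 0 cite); nothing of S30 ∕ S33 ∕ S42 ∕ N0n–N0r ∕ row NE5 ∕ the substrate is
restated — their declarations are used BY NAME.

WHY THIS FILE.  S30 PRODUCED N0r §3's three operator-letter blocks `hm` ∕ `hN` ∕ `hq` at the substrate's CORE LETTERS OF RECORD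
`coreLettersOf A` (`N := gaussN (linForm base rd)`, `q := gaussQ (linForm base rd) coords`) from the substrate's PRIMITIVE per-factor
scalar letter conditions (`margin_pos`, `hN_coreLettersOf`, `hq_coreLettersOf` — p3's `differentiableOn_gaussN_linForm`,
`norm_gaussN_linForm_le`, `differentiableOn_gaussQ ∘ differentiableOn_linForm`, `margin_gaussQ_linForm` BY NAME) and fed them to N0r's
attached-part ∕ μ-part ENDs (S30 §2); S32 ∕ S35 ∕ S36 ∕ S38 carried that slot-letters column further.  The unit's S33 §4 (holomorphy
in the source + the μ-uniform (2.41) envelope; the linear RESPONSE) and S42 (§2 row NE5's `TermLineAnalytic` for core families; §5 the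
JOINT (operator datum, source) END) take the SAME three blocks as binders at ANY letters `ℓ` — at `ℓ := coreLettersOf A` they are
S30 §1's theorems.  THIS FILE does that wiring, nothing else:
* §1 **`termLineAnalytic_coreLettersOf`** — S42 §2 ONCE BY NAME at `𝔊 k p X := coreOf (coreLettersOf A) p.1 p.2` (`actOfLetters ℓ Z j o h
  = (coreOf ℓ Z j).termAt o h` is `rfl`): **row NE5's displayed binder shape `hline : TermLineAnalytic (ballClass ctr ROp RHist) T W` HOLDS
  for `T := the substrate's slot activities at the Gaussian letters of record`**, from `hroom`, `0 ≤ R′ k` and S30's scalar conditions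
  `hbase` ∕ `hrdm` ∕ `hβ₀` ∕ `hd₀` ∕ `hrd` ∕ `hctr` ∕ `hbud` ∕ `hmq` ONLY (no table, no geometry, no (B3));
* §2 **`analytic_and_bounded_locE_of_coreLettersOf`** ∕ **`muDeriv_locE_le_of_coreLettersOf`** — S33 §4's two ENDs ONCE each BY NAME at
  `ℓ := coreLettersOf A` with the letters SPECIALISED as S30 §2 does (`N₀ k p X := gaussC (mI p.1 p.2)·√(max 1 (card!·β₀^{card} + d₀))`,
  `mq k p X := (γ − card·ϑ·R′ k)∕2`, `bq := 0`) — binder census vs S30 §2's `muPart_locE_le_of_coreLettersOf`: MINUS [`h0 : 0 < μ₀`]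
  (holomorphy face: MINUS [`μ₀`, `sμ`, `h0`, `h01`, `hμ`] as well), rest IDENTICAL; conclusions LITERALLY S33 §4's;
* §3 **`analytic_and_bounded_locE_opSource_of_coreLettersOf`** — S42 §5 ONCE BY NAME at `ℓ := coreLettersOf A`: joint holomorphy in
  (operator datum, source) on `ball (ctr k g U).1 (ROp k) ×ˢ ball 0 μ₁` + the (2.41) envelope — here S30 §1's operator-HOLOMORPHY
  clauses are LOAD-BEARING (S42 §1 differentiates in `o`); census vs §2: MINUS [`o`, `hO`].
S30 §3's reading at `(slotsOfRecord …).act` (`slotsOfRecord_act` is `rfl`) applies verbatim to all four and is left to a follower.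

HONEST FRAMING.  By-name kernel wiring: the unit's source-analytic ∕ response ∕ joint ENDs and row NE5's `TermLineAnalytic` re-socketed
at the substrate's Gaussian letters of record, the operator-letter blocks discharged into the substrate's DISPLAYED per-factor scalar
conditions (S-U3 currency: `hbase` ∕ `hrdm`, `β₀`, `ϑ`, `d₀`, `γ`, the CENTRE CONDITIONS `hctr`, the radius smallnesses `hbud` ∕ `hmq`)
over p3's PROVED finite-dimensional lemmas; (B1a) kernel as in S33∕S42 — a relocation onto the Gaussian LETTER hypotheses; WHICH tables
`base` ∕ `rd` ∕ `coords` realise Bałaban's `C^{(k)}(Z₀,σ)`, `Γ_k` of [Balaban1988RGII] (2.14) p. 15, whether the datum of record meets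
the centre conditions, and the identification of the class centre with run B's operator datum of record are the SUBSTRATE's ∕ the
owner's DISPLAYED readings, NOT claimed; row NE5's wall line «`TermLineAnalytic` of the (2.14)-terms» concerns Bałaban's resummed terms
— for the substrate's slot family it is hereby kernel MODULO those displayed scalar conditions, for Bałaban's terms NOT claimed; (B1b)'s
residue (`terms` ∕ `emb` ∕ `hscale`), (B3) = `hM3` (G-ne9p2-5 UNPRINTED, shared with NE9), the clause SHAPES and `hO` ∕ `hH` stay
DISPLAYED; no numeral of print; 0 binders instantiated on Bałaban's densities; no new inequality; no wall item of NE1′ or NE5 moves;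
wall v1.7 (T4-DAG v46) does NOT move; R-t4r2-Q2 NOT met.  NE1′ ⇐ the named binders — NOT proved, NOT printed; spine PROVED 0∕9;
count 9 unchanged.  Rung (B)+1 on ONE finite four-torus — NOT infinite volume, NOT a mass gap, NOT OS on ℝ⁴, NOT Clay.  HONEST
DEPENDENCY: continuum YM on T⁴ ⇐ BetaPertH ∧ nine spine estimates (0/9 proved); BetaPertH ⇐ (D1) ∧ (D4) ∧ CAP+tail; G-an2-4 gates
asym, D1 and NE2/3/4.
-/

noncomputable section

namespace Summit.QuantumFields.BalabanUV.T4Continuum.NE1p.DressedSourceAnalyticSlotLetters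

open scoped BigOperators Matrix
open Metric Set MeasureTheory
open Literature.MathematicalPhysics.QuantumFieldTheory.Balaban1983to89
open Literature.MathematicalPhysics.QuantumFieldTheory.Balaban1983to89.B13Resummation (locE Geometry)
open Literature.MathematicalPhysics.QuantumFieldTheory.Balaban1983to89.B5Prop11Lower (nsq)
open Literature.MathematicalPhysics.QuantumFieldTheory.Balaban1983to89.T4InputCauchyRateSpecies (ballClass)
open Literature.MathematicalPhysics.QuantumFieldTheory.Balaban1983to89.T4InputCauchyRateTermwise (TermLineAnalytic)
open Summit.QuantumFields.BalabanUV.T4Continuum.B13HistMeasurable (MeasPotFrame B13HistM)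
open Summit.QuantumFields.BalabanUV.T4Continuum.SubstrateTwoRunsDriven (DrivenRuns)
open Summit.QuantumFields.BalabanUV.T4Continuum.SubstrateActivities (coreOf actOfLetters)
open Summit.QuantumFields.BalabanUV.T4Continuum.SubstrateGaussianLetters (gaussC linForm)
open Summit.QuantumFields.BalabanUV.T4Continuum.SubstrateGaussianLettersBall (detBudget)
open Summit.QuantumFields.BalabanUV.T4Continuum.SubstrateSlotsOfRecord (ActLetters coreLettersOf)
open Summit.QuantumFields.BalabanUV.T4Continuum.NE1p.DressedSmallFieldOnCoresSlotLetters (margin_pos hN_coreLettersOf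
  hq_coreLettersOf)
open Summit.QuantumFields.BalabanUV.T4Continuum.NE1p.DressedSourceAnalyticOnCores (analytic_and_bounded_locE_of_actOfLetters
  muDeriv_locE_le_of_actOfLetters)
open Summit.QuantumFields.BalabanUV.T4Continuum.NE1p.DressedJointAnalyticOnCores (termLineAnalytic_termAt
  analytic_and_bounded_locE_opSource_of_actOfLetters)

variable {G : Type} [GaugeGroup G] (D : DrivenRuns G) (P : MeasPotFrame D.carriers)

section CoreLettersOf

variable (Op : Type) [NormedAddCommGroup Op] [NormedSpace ℂ Op] {J : Type}
  (𝒵 : D.carriers.Dom → J → Type) [∀ Z j, Fintype (𝒵 Z j)] (dom : ∀ Z j, 𝒵 Z j → D.carriers.Dom)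
  (Jc : D.carriers.Dom → J → Type) [∀ Z j, Fintype (Jc Z j)]
  (V : D.carriers.Dom → J → Type) [∀ Z j, NormedAddCommGroup (V Z j)] [∀ Z j, InnerProductSpace ℝ (V Z j)]
  [∀ Z j, MeasurableSpace (V Z j)] [∀ Z j, BorelSpace (V Z j)] [∀ Z j, FiniteDimensional ℝ (V Z j)]
  (mI : D.carriers.Dom → J → Type) [∀ Z j, Fintype (mI Z j)] [∀ Z j, DecidableEq (mI Z j)]

/-! ## §1 ROW NE5's `TermLineAnalytic` FOR THE SLOT ACTIVITIES AT THE CORE LETTERS OF RECORD -/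

/-- **ROW NE5's `TermLineAnalytic` HOLDS FOR THE SUBSTRATE'S SLOT ACTIVITIES AT THE GAUSSIAN LETTERS OF RECORD** (kernel; S42 §2
`termLineAnalytic_termAt` ONCE BY NAME at the family `𝔊 k p X := coreOf (coreLettersOf A) p.1 p.2` — `actOfLetters ℓ Z j o h =
(coreOf ℓ Z j).termAt o h` is `rfl` — with N0r's three operator-letter blocks PRODUCED by S30 §1 (`margin_pos`, `hN_coreLettersOf`,
`hq_coreLettersOf`) from the substrate's PRIMITIVE per-factor scalar letter conditions).  Binders, all DISPLAYED and LITERALLY S30's: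
the room `hroom`, `0 ≤ R′ k`; `hbase` ∕ `hrdm` (measurability of the tables in the contour parameter), `0 ≤ β₀`, `0 < d₀`, the read-out
bound `hrd`, the CENTRE CONDITIONS `hctr` at every class centre (entries `≤ β₀`, determinant real with real part `≥ d₀`,
`γ`-coercivity), the two radius smallnesses `hbud` ∕ `hmq`.  Conclusion LITERALLY row NE5's displayed binder shape `hline`:
`TermLineAnalytic (ballClass ctr ROp RHist) (fun k p o h X => actOfLetters … (coreLettersOf … A) p.1 p.2 o h) W` — along every complex
segment `ζ ↦ (o + ζu, h + ζv)` whose closed unit part lies in the ball class, every slot activity is complex differentiable. [folklore] -/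
theorem termLineAnalytic_coreLettersOf {W : Set (ℕ → ℝ)} {ctr : ℕ → (ℕ → ℝ) → D.carriers.BgB → Op × B13HistM P}
    {ROp RHist R' : ℕ → ℝ} (A : ∀ Z j, ActLetters D P Op 𝒵 dom Jc V mI Z j) {β₀ ϑ d₀ γ : D.carriers.Dom → J → ℝ}
    (hroom : ∀ k, ROp k < R' k) (hR' : ∀ k, 0 ≤ R' k)
    (hbase : ∀ Z j ii jj, Measurable fun a => (A Z j).base a ii jj)
    (hrdm : ∀ Z j ii jj (o' : Op), Measurable fun a => (A Z j).rd a ii jj o')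
    (hβ₀ : ∀ Z j, 0 ≤ β₀ Z j) (hd₀ : ∀ Z j, 0 < d₀ Z j)
    (hrd : ∀ Z j a ii jj, ‖(A Z j).rd a ii jj‖ ≤ ϑ Z j)
    (hctr : ∀ k, ∀ g ∈ W, ∀ (U : D.carriers.BgB) (Z : D.carriers.Dom) (j : J) (a : (Jc Z j ⊕ 𝒵 Z j) → ℝ × ℝ),
      (∀ ii jj, ‖linForm (A Z j).base (A Z j).rd (ctr k g U).1 a ii jj‖ ≤ β₀ Z j) ∧
      ((linForm (A Z j).base (A Z j).rd (ctr k g U).1 a).det).im = 0 ∧ d₀ Z j ≤ ((linForm (A Z j).base (A Z j).rd (ctr k g U).1 a).det).re ∧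
      (∀ x : mI Z j → ℂ, γ Z j * nsq x ≤ (star x ⬝ᵥ (linForm (A Z j).base (A Z j).rd (ctr k g U).1 a *ᵥ x)).re))
    (hbud : ∀ k Z j, detBudget (Fintype.card (mI Z j)) (β₀ Z j) (ϑ Z j) (R' k) < d₀ Z j)
    (hmq : ∀ k Z j, Fintype.card (mI Z j) * ϑ Z j * R' k < γ Z j) :
    TermLineAnalytic (ballClass ctr ROp RHist)
      (fun (_ : ℕ) (p : D.carriers.Dom × J) (o : Op) (h : B13HistM P) (_ : D.carriers.Dom) =>
        actOfLetters P Op 𝒵 dom Jc V (coreLettersOf D P Op 𝒵 dom Jc V mI A) p.1 p.2 o h) W :=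
  termLineAnalytic_termAt (ctr := ctr) (ROp := ROp) (RHist := RHist) (R' := R')
    (fun (_ : ℕ) (p : D.carriers.Dom × J) (_ : D.carriers.Dom) => coreOf P Op 𝒵 dom Jc V (coreLettersOf D P Op 𝒵 dom Jc V mI A) p.1 p.2)
    (m := fun k p _ => (γ p.1 p.2 - Fintype.card (mI p.1 p.2) * ϑ p.1 p.2 * R' k) / 2) (b := fun _ _ _ => 0)
    (N₀ := fun _ p _ => gaussC (mI p.1 p.2) *
      Real.sqrt (max 1 ((Fintype.card (mI p.1 p.2)).factorial * β₀ p.1 p.2 ^ Fintype.card (mI p.1 p.2) + d₀ p.1 p.2)))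
    hroom (margin_pos D mI hmq) (hN_coreLettersOf D P Op 𝒵 dom Jc V mI A hR' hbase hrdm hβ₀ hd₀ hrd hctr hbud)
    (hq_coreLettersOf D P Op 𝒵 dom Jc V mI A hbase hrdm hrd hctr)

/-! ## §2 S33 §4's SOURCE-ANALYTIC AND RESPONSE ENDs AT THE CORE LETTERS OF RECORD, operator letters DISCHARGED -/

variable (𝔇 : LocDomainSys) {Cube : Type} [DecidableEq Cube] (Ge : Geometry 𝔇 Cube)

open Classical in
/-- **HOLOMORPHY IN THE SOURCE + THE μ-UNIFORM (2.41) ENVELOPE OF THE DRESSED OUTPUT OF THE SLOT ACTIVITIES AT THE CORE LETTERS OF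
RECORD, OPERATOR LETTERS DISCHARGED** (kernel; S33 §4 `analytic_and_bounded_locE_of_actOfLetters` ONCE BY NAME at
`ℓ := coreLettersOf D P Op 𝒵 dom Jc V mI A`, letters `N₀ k p X := gaussC (mI p.1 p.2)·√(max 1 (card!·β₀ Z′ j^{card} + d₀ Z′ j))`,
`mq k p X := (γ Z′ j − card·ϑ Z′ j·R′ k)/2`, `bq := 0`, blocks `hm` ∕ `hN` ∕ `hq` from S30 §1 — S30 §2's pattern VERBATIM).  Binders,
all DISPLAYED: `hroom`, `0 ≤ R′ k`; the substrate's primitive letter conditions `hbase` ∕ `hrdm` ∕ `hβ₀` ∕ `hd₀` ∕ `hrd`, the CENTRE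
CONDITIONS `hctr`, the radius smallnesses `hbud` ∕ `hmq`; then S33 §4's VERBATIM (`hO` ∕ `hH` at the source radius `μ₁`, `hscale`,
`terms`, the clauses, (B3) `hM3` on the explicit letters).  Conclusion LITERALLY S33 §4's: `s ↦ E[Σ_{p ∈ terms Z} actOfLetters
(coreLettersOf A) p.1 p.2 o (h₀ + s • v)](X₀)` is complex differentiable on `‖s‖ < μ₁` and bounded there by `e·ν·c₁·K₀²·A′·e^{−r₁ d(X₀)}`.
Nothing of the substrate's data is asserted. [folklore] -/
theorem analytic_and_bounded_locE_of_coreLettersOf {W : Set (ℕ → ℝ)} {ctr : ℕ → (ℕ → ℝ) → D.carriers.BgB → Op × B13HistM P}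
    {ROp RHist R' : ℕ → ℝ} (A : ∀ Z j, ActLetters D P Op 𝒵 dom Jc V mI Z j) {β₀ ϑ d₀ γ : D.carriers.Dom → J → ℝ}
    (hroom : ∀ k, ROp k < R' k) (hR' : ∀ k, 0 ≤ R' k)
    (hbase : ∀ Z j ii jj, Measurable fun a => (A Z j).base a ii jj)
    (hrdm : ∀ Z j ii jj (o' : Op), Measurable fun a => (A Z j).rd a ii jj o')
    (hβ₀ : ∀ Z j, 0 ≤ β₀ Z j) (hd₀ : ∀ Z j, 0 < d₀ Z j)
    (hrd : ∀ Z j a ii jj, ‖(A Z j).rd a ii jj‖ ≤ ϑ Z j)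
    (hctr : ∀ k, ∀ g ∈ W, ∀ (U : D.carriers.BgB) (Z : D.carriers.Dom) (j : J) (a : (Jc Z j ⊕ 𝒵 Z j) → ℝ × ℝ),
      (∀ ii jj, ‖linForm (A Z j).base (A Z j).rd (ctr k g U).1 a ii jj‖ ≤ β₀ Z j) ∧
      ((linForm (A Z j).base (A Z j).rd (ctr k g U).1 a).det).im = 0 ∧ d₀ Z j ≤ ((linForm (A Z j).base (A Z j).rd (ctr k g U).1 a).det).re ∧
      (∀ x : mI Z j → ℂ, γ Z j * nsq x ≤ (star x ⬝ᵥ (linForm (A Z j).base (A Z j).rd (ctr k g U).1 a *ᵥ x)).re))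
    (hbud : ∀ k Z j, detBudget (Fintype.card (mI Z j)) (β₀ Z j) (ϑ Z j) (R' k) < d₀ Z j)
    (hmq : ∀ k Z j, Fintype.card (mI Z j) * ϑ Z j * R' k < γ Z j)
    {k : ℕ} {g : ℕ → ℝ} (hg : g ∈ W) {U : D.carriers.BgB} {o : Op} {h₀ v : B13HistM P} {μ₁ : ℝ}
    (hO : ‖o - (ctr k g U).1‖ ≤ ROp k) (hH : ‖h₀ - (ctr k g U).2‖ + μ₁ * ‖v‖ ≤ RHist k)
    {emb : 𝔇.Dom → D.carriers.Dom} (hscale : ∀ Z, D.carriers.scale (emb Z) = k)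
    (terms : 𝔇.Dom → Finset (D.carriers.Dom × J))
    {A' R r₁ b₅ : ℝ} {X₀ : 𝔇.Dom} (hA : 0 ≤ A') (hr₁ : 0 ≤ r₁) (hb : r₁ * 5 ≤ b₅)
    (hrate : r₁ + 2 * Ge.κ₀ + 2 ≤ R) (hsmall : A' * Real.exp (b₅ + 1) * Ge.K₀ * Ge.ν * Ge.c₁ ≤ 1)
    (hM3 : ∀ Z, Ge.cubes Z ⊆ Ge.cubes X₀ →
      ∑ p ∈ terms Z, (coreOf P Op 𝒵 dom Jc V (coreLettersOf D P Op 𝒵 dom Jc V mI A) p.1 p.2).lam.real univ *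
          ((coreOf P Op 𝒵 dom Jc V (coreLettersOf D P Op 𝒵 dom Jc V mI A) p.1 p.2).wB *
              (gaussC (mI p.1 p.2) * Real.sqrt (max 1 ((Fintype.card (mI p.1 p.2)).factorial *
                β₀ p.1 p.2 ^ Fintype.card (mI p.1 p.2) + d₀ p.1 p.2))) * Real.exp 0) *
          (Real.pi / ((γ p.1 p.2 - Fintype.card (mI p.1 p.2) * ϑ p.1 p.2 * R' k) / 2 / 2)) ^ (Module.finrank ℝ (V p.1 p.2) / 2 : ℝ) *
        Real.exp ((coreOf P Op 𝒵 dom Jc V (coreLettersOf D P Op 𝒵 dom Jc V mI A) p.1 p.2).N₁ * (‖h₀‖ + μ₁ * ‖v‖)) ≤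
        A' * Real.exp (-(R * 𝔇.dj Z))) :
    DifferentiableOn ℂ (fun s => locE Ge.ι Ge.cubes (fun Z => ∑ p ∈ terms Z,
        actOfLetters P Op 𝒵 dom Jc V (coreLettersOf D P Op 𝒵 dom Jc V mI A) p.1 p.2 o (h₀ + s • v)) (Ge.cubes X₀))
        (ball (0 : ℂ) μ₁) ∧
      ∀ s ∈ ball (0 : ℂ) μ₁, ‖locE Ge.ι Ge.cubes (fun Z => ∑ p ∈ terms Z,
          actOfLetters P Op 𝒵 dom Jc V (coreLettersOf D P Op 𝒵 dom Jc V mI A) p.1 p.2 o (h₀ + s • v)) (Ge.cubes X₀)‖ ≤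
        Real.exp 1 * Ge.ν * Ge.c₁ * Ge.K₀ ^ 2 * A' * Real.exp (-(r₁ * 𝔇.dj X₀)) :=
  analytic_and_bounded_locE_of_actOfLetters P Op 𝒵 dom Jc V 𝔇 Ge (coreLettersOf D P Op 𝒵 dom Jc V mI A)
    (mq := fun k p _ => (γ p.1 p.2 - Fintype.card (mI p.1 p.2) * ϑ p.1 p.2 * R' k) / 2) (bq := fun _ _ _ => 0)
    (N₀ := fun _ p _ => gaussC (mI p.1 p.2) *
      Real.sqrt (max 1 ((Fintype.card (mI p.1 p.2)).factorial * β₀ p.1 p.2 ^ Fintype.card (mI p.1 p.2) + d₀ p.1 p.2)))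
    hroom (margin_pos D mI hmq) (hN_coreLettersOf D P Op 𝒵 dom Jc V mI A hR' hbase hrdm hβ₀ hd₀ hrd hctr hbud)
    (hq_coreLettersOf D P Op 𝒵 dom Jc V mI A hbase hrdm hrd hctr) hg hO hH hscale terms hA hr₁ hb hrate hsmall hM3

open Classical in
/-- **LINEAR RESPONSE OF THE DRESSED OUTPUT OF THE SLOT ACTIVITIES AT THE CORE LETTERS OF RECORD, OPERATOR LETTERS DISCHARGED**
(kernel; S33 §4 `muDeriv_locE_le_of_actOfLetters` ONCE BY NAME at `ℓ := coreLettersOf … A`, letters and blocks as above): for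
`‖sμ‖ ≤ μ₀ < μ₁` the source derivative of `s ↦ E[Σ actOfLetters (coreLettersOf A) … o (h₀ + s • v)](X₀)` at `sμ` is
`≤ 2·(e·ν·c₁·K₀²·A′·e^{−r₁ d(X₀)})∕(μ₁ − μ₀)` — the response END feeding `DressedSmallFieldAllowance`, now at the substrate's letters.
[folklore] -/
theorem muDeriv_locE_le_of_coreLettersOf {W : Set (ℕ → ℝ)} {ctr : ℕ → (ℕ → ℝ) → D.carriers.BgB → Op × B13HistM P}
    {ROp RHist R' : ℕ → ℝ} (A : ∀ Z j, ActLetters D P Op 𝒵 dom Jc V mI Z j) {β₀ ϑ d₀ γ : D.carriers.Dom → J → ℝ}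
    (hroom : ∀ k, ROp k < R' k) (hR' : ∀ k, 0 ≤ R' k)
    (hbase : ∀ Z j ii jj, Measurable fun a => (A Z j).base a ii jj)
    (hrdm : ∀ Z j ii jj (o' : Op), Measurable fun a => (A Z j).rd a ii jj o')
    (hβ₀ : ∀ Z j, 0 ≤ β₀ Z j) (hd₀ : ∀ Z j, 0 < d₀ Z j)
    (hrd : ∀ Z j a ii jj, ‖(A Z j).rd a ii jj‖ ≤ ϑ Z j)
    (hctr : ∀ k, ∀ g ∈ W, ∀ (U : D.carriers.BgB) (Z : D.carriers.Dom) (j : J) (a : (Jc Z j ⊕ 𝒵 Z j) → ℝ × ℝ),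
      (∀ ii jj, ‖linForm (A Z j).base (A Z j).rd (ctr k g U).1 a ii jj‖ ≤ β₀ Z j) ∧
      ((linForm (A Z j).base (A Z j).rd (ctr k g U).1 a).det).im = 0 ∧ d₀ Z j ≤ ((linForm (A Z j).base (A Z j).rd (ctr k g U).1 a).det).re ∧
      (∀ x : mI Z j → ℂ, γ Z j * nsq x ≤ (star x ⬝ᵥ (linForm (A Z j).base (A Z j).rd (ctr k g U).1 a *ᵥ x)).re))
    (hbud : ∀ k Z j, detBudget (Fintype.card (mI Z j)) (β₀ Z j) (ϑ Z j) (R' k) < d₀ Z j)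
    (hmq : ∀ k Z j, Fintype.card (mI Z j) * ϑ Z j * R' k < γ Z j)
    {k : ℕ} {g : ℕ → ℝ} (hg : g ∈ W) {U : D.carriers.BgB} {o : Op} {h₀ v : B13HistM P} {μ₁ : ℝ}
    (hO : ‖o - (ctr k g U).1‖ ≤ ROp k) (hH : ‖h₀ - (ctr k g U).2‖ + μ₁ * ‖v‖ ≤ RHist k)
    {emb : 𝔇.Dom → D.carriers.Dom} (hscale : ∀ Z, D.carriers.scale (emb Z) = k)
    (terms : 𝔇.Dom → Finset (D.carriers.Dom × J))
    {A' R r₁ b₅ μ₀ : ℝ} {X₀ : 𝔇.Dom} {sμ : ℂ} (hA : 0 ≤ A') (hr₁ : 0 ≤ r₁) (hb : r₁ * 5 ≤ b₅)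
    (hrate : r₁ + 2 * Ge.κ₀ + 2 ≤ R) (hsmall : A' * Real.exp (b₅ + 1) * Ge.K₀ * Ge.ν * Ge.c₁ ≤ 1)
    (hM3 : ∀ Z, Ge.cubes Z ⊆ Ge.cubes X₀ →
      ∑ p ∈ terms Z, (coreOf P Op 𝒵 dom Jc V (coreLettersOf D P Op 𝒵 dom Jc V mI A) p.1 p.2).lam.real univ *
          ((coreOf P Op 𝒵 dom Jc V (coreLettersOf D P Op 𝒵 dom Jc V mI A) p.1 p.2).wB *
              (gaussC (mI p.1 p.2) * Real.sqrt (max 1 ((Fintype.card (mI p.1 p.2)).factorial *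
                β₀ p.1 p.2 ^ Fintype.card (mI p.1 p.2) + d₀ p.1 p.2))) * Real.exp 0) *
          (Real.pi / ((γ p.1 p.2 - Fintype.card (mI p.1 p.2) * ϑ p.1 p.2 * R' k) / 2 / 2)) ^ (Module.finrank ℝ (V p.1 p.2) / 2 : ℝ) *
        Real.exp ((coreOf P Op 𝒵 dom Jc V (coreLettersOf D P Op 𝒵 dom Jc V mI A) p.1 p.2).N₁ * (‖h₀‖ + μ₁ * ‖v‖)) ≤
        A' * Real.exp (-(R * 𝔇.dj Z)))
    (h01 : μ₀ < μ₁) (hμ : ‖sμ‖ ≤ μ₀) :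
    ‖deriv (fun s => locE Ge.ι Ge.cubes (fun Z => ∑ p ∈ terms Z,
        actOfLetters P Op 𝒵 dom Jc V (coreLettersOf D P Op 𝒵 dom Jc V mI A) p.1 p.2 o (h₀ + s • v)) (Ge.cubes X₀)) sμ‖ ≤
      2 * (Real.exp 1 * Ge.ν * Ge.c₁ * Ge.K₀ ^ 2 * A' * Real.exp (-(r₁ * 𝔇.dj X₀))) / (μ₁ - μ₀) :=
  muDeriv_locE_le_of_actOfLetters P Op 𝒵 dom Jc V 𝔇 Ge (coreLettersOf D P Op 𝒵 dom Jc V mI A)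
    (mq := fun k p _ => (γ p.1 p.2 - Fintype.card (mI p.1 p.2) * ϑ p.1 p.2 * R' k) / 2) (bq := fun _ _ _ => 0)
    (N₀ := fun _ p _ => gaussC (mI p.1 p.2) *
      Real.sqrt (max 1 ((Fintype.card (mI p.1 p.2)).factorial * β₀ p.1 p.2 ^ Fintype.card (mI p.1 p.2) + d₀ p.1 p.2)))
    hroom (margin_pos D mI hmq) (hN_coreLettersOf D P Op 𝒵 dom Jc V mI A hR' hbase hrdm hβ₀ hd₀ hrd hctr hbud)
    (hq_coreLettersOf D P Op 𝒵 dom Jc V mI A hbase hrdm hrd hctr) hg hO hH hscale terms hA hr₁ hb hrate hsmall hM3 h01 hμ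

/-! ## §3 S42 §5's JOINT (OPERATOR DATUM, SOURCE) END AT THE CORE LETTERS OF RECORD, operator letters DISCHARGED -/

open Classical in
/-- **JOINT HOLOMORPHY IN (OPERATOR DATUM, SOURCE) + THE (2.41) ENVELOPE OF THE DRESSED OUTPUT OF THE SLOT ACTIVITIES AT THE CORE
LETTERS OF RECORD, OPERATOR LETTERS DISCHARGED** (kernel; S42 §5 `analytic_and_bounded_locE_opSource_of_actOfLetters` ONCE BY NAME at
`ℓ := coreLettersOf … A`, letters and blocks as in §2 — here S30 §1's HOLOMORPHY clauses (`differentiableOn_gaussN_linForm`,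
`differentiableOn_gaussQ ∘ differentiableOn_linForm`) are LOAD-BEARING: S42 §1 differentiates the term in the operator datum).  Binders
= §2's WITHOUT `o` ∕ `hO` (the operator datum ranges over the open class ball).  Conclusion LITERALLY S42 §5's: `(o, s) ↦ E[Σ actOfLetters
(coreLettersOf A) … o (h₀ + s • v)](X₀)` is complex differentiable on `ball (ctr k g U).1 (ROp k) ×ˢ ball 0 μ₁` and bounded there by
`e·ν·c₁·K₀²·A′·e^{−r₁ d(X₀)}`. [folklore] -/
theorem analytic_and_bounded_locE_opSource_of_coreLettersOf {W : Set (ℕ → ℝ)}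
    {ctr : ℕ → (ℕ → ℝ) → D.carriers.BgB → Op × B13HistM P}
    {ROp RHist R' : ℕ → ℝ} (A : ∀ Z j, ActLetters D P Op 𝒵 dom Jc V mI Z j) {β₀ ϑ d₀ γ : D.carriers.Dom → J → ℝ}
    (hroom : ∀ k, ROp k < R' k) (hR' : ∀ k, 0 ≤ R' k)
    (hbase : ∀ Z j ii jj, Measurable fun a => (A Z j).base a ii jj)
    (hrdm : ∀ Z j ii jj (o' : Op), Measurable fun a => (A Z j).rd a ii jj o')
    (hβ₀ : ∀ Z j, 0 ≤ β₀ Z j) (hd₀ : ∀ Z j, 0 < d₀ Z j)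
    (hrd : ∀ Z j a ii jj, ‖(A Z j).rd a ii jj‖ ≤ ϑ Z j)
    (hctr : ∀ k, ∀ g ∈ W, ∀ (U : D.carriers.BgB) (Z : D.carriers.Dom) (j : J) (a : (Jc Z j ⊕ 𝒵 Z j) → ℝ × ℝ),
      (∀ ii jj, ‖linForm (A Z j).base (A Z j).rd (ctr k g U).1 a ii jj‖ ≤ β₀ Z j) ∧
      ((linForm (A Z j).base (A Z j).rd (ctr k g U).1 a).det).im = 0 ∧ d₀ Z j ≤ ((linForm (A Z j).base (A Z j).rd (ctr k g U).1 a).det).re ∧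
      (∀ x : mI Z j → ℂ, γ Z j * nsq x ≤ (star x ⬝ᵥ (linForm (A Z j).base (A Z j).rd (ctr k g U).1 a *ᵥ x)).re))
    (hbud : ∀ k Z j, detBudget (Fintype.card (mI Z j)) (β₀ Z j) (ϑ Z j) (R' k) < d₀ Z j)
    (hmq : ∀ k Z j, Fintype.card (mI Z j) * ϑ Z j * R' k < γ Z j)
    {k : ℕ} {g : ℕ → ℝ} (hg : g ∈ W) {U : D.carriers.BgB} {h₀ v : B13HistM P} {μ₁ : ℝ}
    (hH : ‖h₀ - (ctr k g U).2‖ + μ₁ * ‖v‖ ≤ RHist k)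
    {emb : 𝔇.Dom → D.carriers.Dom} (hscale : ∀ Z, D.carriers.scale (emb Z) = k)
    (terms : 𝔇.Dom → Finset (D.carriers.Dom × J))
    {A' R r₁ b₅ : ℝ} {X₀ : 𝔇.Dom} (hA : 0 ≤ A') (hr₁ : 0 ≤ r₁) (hb : r₁ * 5 ≤ b₅)
    (hrate : r₁ + 2 * Ge.κ₀ + 2 ≤ R) (hsmall : A' * Real.exp (b₅ + 1) * Ge.K₀ * Ge.ν * Ge.c₁ ≤ 1)
    (hM3 : ∀ Z, Ge.cubes Z ⊆ Ge.cubes X₀ →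
      ∑ p ∈ terms Z, (coreOf P Op 𝒵 dom Jc V (coreLettersOf D P Op 𝒵 dom Jc V mI A) p.1 p.2).lam.real univ *
          ((coreOf P Op 𝒵 dom Jc V (coreLettersOf D P Op 𝒵 dom Jc V mI A) p.1 p.2).wB *
              (gaussC (mI p.1 p.2) * Real.sqrt (max 1 ((Fintype.card (mI p.1 p.2)).factorial *
                β₀ p.1 p.2 ^ Fintype.card (mI p.1 p.2) + d₀ p.1 p.2))) * Real.exp 0) *
          (Real.pi / ((γ p.1 p.2 - Fintype.card (mI p.1 p.2) * ϑ p.1 p.2 * R' k) / 2 / 2)) ^ (Module.finrank ℝ (V p.1 p.2) / 2 : ℝ) *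
        Real.exp ((coreOf P Op 𝒵 dom Jc V (coreLettersOf D P Op 𝒵 dom Jc V mI A) p.1 p.2).N₁ * (‖h₀‖ + μ₁ * ‖v‖)) ≤
        A' * Real.exp (-(R * 𝔇.dj Z))) :
    DifferentiableOn ℂ (fun z : Op × ℂ => locE Ge.ι Ge.cubes (fun Z => ∑ p ∈ terms Z,
        actOfLetters P Op 𝒵 dom Jc V (coreLettersOf D P Op 𝒵 dom Jc V mI A) p.1 p.2 z.1 (h₀ + z.2 • v)) (Ge.cubes X₀))
        (ball (ctr k g U).1 (ROp k) ×ˢ ball (0 : ℂ) μ₁) ∧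
      ∀ z ∈ ball (ctr k g U).1 (ROp k) ×ˢ ball (0 : ℂ) μ₁, ‖locE Ge.ι Ge.cubes (fun Z => ∑ p ∈ terms Z,
          actOfLetters P Op 𝒵 dom Jc V (coreLettersOf D P Op 𝒵 dom Jc V mI A) p.1 p.2 z.1 (h₀ + z.2 • v)) (Ge.cubes X₀)‖ ≤
        Real.exp 1 * Ge.ν * Ge.c₁ * Ge.K₀ ^ 2 * A' * Real.exp (-(r₁ * 𝔇.dj X₀)) :=
  analytic_and_bounded_locE_opSource_of_actOfLetters P Op 𝒵 dom Jc V 𝔇 Ge (coreLettersOf D P Op 𝒵 dom Jc V mI A)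
    (mq := fun k p _ => (γ p.1 p.2 - Fintype.card (mI p.1 p.2) * ϑ p.1 p.2 * R' k) / 2) (bq := fun _ _ _ => 0)
    (N₀ := fun _ p _ => gaussC (mI p.1 p.2) *
      Real.sqrt (max 1 ((Fintype.card (mI p.1 p.2)).factorial * β₀ p.1 p.2 ^ Fintype.card (mI p.1 p.2) + d₀ p.1 p.2)))
    hroom (margin_pos D mI hmq) (hN_coreLettersOf D P Op 𝒵 dom Jc V mI A hR' hbase hrdm hβ₀ hd₀ hrd hctr hbud)
    (hq_coreLettersOf D P Op 𝒵 dom Jc V mI A hbase hrdm hrd hctr) hg hH hscale terms hA hr₁ hb hrate hsmall hM3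

end CoreLettersOf

end Summit.QuantumFields.BalabanUV.T4Continuum.NE1p.DressedSourceAnalyticSlotLetters

end
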